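import Literature.Topology.FourManifolds.KirbyMovesIsotopyProofs
import Literature.Topology.FourManifolds.KirbyMovesReverseProofs
import Literature.Topology.FourManifolds.FramedTubularNbhd
import HarnessLib

/-!
# Oriented tubular neighbourhoods from injective local diffeomorphisms `S¹ × ℝ² → S³`

Topic `Literature/Topology/FourManifolds`; general infrastructure (used by the blow-down model,
`BlowDownModelSphere.lean`). An oriented tubular neighbourhood of a knot `K`
(`Literature.Topology.FourManifolds.Knot.TubularNbhd K`, `DehnSurgery.lean`) is a smooth
embedding `ν : S¹ × ℝ² ↪ S³` with zero section `K` which is *positively oriented*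
(`det_pos`: the Jacobian frame `(ν, ∂_θ ν, ∂_{w₀} ν, ∂_{w₁} ν)` in `ℝ⁴ ⊇ S³` has positive
determinant). We prove that **every injective local diffeomorphism `f : S¹ × ℝ² → S³` with
`f (x, 0) = K x` yields one**: either `f` itself or its fibre reflection
`(x, (w₀, w₁)) ↦ f (x, (w₀, -w₁))` (`Knot.TubularNbhd.ofLocalDiffeomorph`,
`Knot.TubularNbhd.ofLocalDiffeomorph_apply_or`; the fibre reflection is the tree's `planeFlip`
(`KirbyMovesReverseProofs.lean`), and `Knot.TubularNbhd.reverse` there is the circle reflection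
composed with this fibre flip).

Proof: `f` is a smooth embedding (the tree's `isSmoothEmbedding_of_isLocalDiffeomorph`,
`FramedTubularNbhd.lean`); its frame determinant in the angle coordinate never vanishes
(`tubeFrameDet_coordOf_ne_zero`: by the chain rule the three derivative rows are the images of a
basis under the injective linear map `d(ι) ∘ df ∘ d(circlePoint × id)`, all orthogonal to the
unit position vector — the pattern of `tubeFrameDet_isoStage_ne_zero`,
`KirbyMovesIsotopyProofs.lean`), is continuous, hence of constant sign on the connected
`ℝ × ℝ²` (`tubeFrameDet_coordOf_pos_or_neg`); and the fibre reflection changes the sign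
(`tubeFrameDet_coordOf_fibreReflect`). Hirsch, *Differential Topology* (1976), Ch. 4 §5
(tubular neighbourhoods; the orientation of the normal bundle of a knot in `S³`). Everything in
this file is proved.

## References

* M. W. Hirsch, *Differential Topology*, GTM 33, Springer (1976), Ch. 4 §5. [cite: Hirsch1976, §4.5 Thm 5.2]
-/

open scoped Manifold ContDiff Topology RealInnerProductSpace
open Function Set

noncomputable section

namespace Literature.Topology.FourManifolds

/-- Local notation: `𝔼 n` is the model Euclidean space `EuclideanSpace ℝ (Fin n)`. -/
local notation "𝔼 " n:arg => EuclideanSpace ℝ (Fin n)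

/-- Local notation: `𝕊 n` is the unit sphere in `EuclideanSpace ℝ (Fin (n + 1))`. -/
local notation "𝕊 " n:arg => (Metric.sphere (0 : EuclideanSpace ℝ (Fin (n + 1))) 1)

/-- Local notation: the model with corners of `S¹ × ℝ²`. -/
local notation "𝓘₁₂" => (ModelWithCorners.prod (𝓡 1) 𝓘(ℝ, EuclideanSpace ℝ (Fin 2)))

attribute [local instance] fact_finrank_euclideanSpace_two fact_finrank_euclideanSpace_four

/-! ### The angle parametrisation `ℝ × ℝ² → S¹ × ℝ²` -/

section AngleParam

/-- The angle parametrisation `(θ, w) ↦ (circlePoint θ, w)` of `S¹ × ℝ²`. [folklore] -/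
def angleParam (q : ℝ × 𝔼 2) : (𝕊 1) × 𝔼 2 := (circlePoint q.1, q.2)

/-- Unfolding of `angleParam`. [folklore] -/
theorem angleParam_apply (q : ℝ × 𝔼 2) : angleParam q = (circlePoint q.1, q.2) := rfl

/-- The angle parametrisation is smooth. [folklore] -/
theorem contMDiff_angleParam : ContMDiff 𝓘(ℝ, ℝ × 𝔼 2) 𝓘₁₂ ∞ angleParam :=
  (contMDiff_circlePoint.comp (ContinuousLinearMap.fst ℝ ℝ (𝔼 2)).contMDiff).prodMk
    (ContinuousLinearMap.snd ℝ ℝ (𝔼 2)).contMDiff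

/-- **The differential of the angle parametrisation is injective**: followed by
`S¹ × ℝ² ⊆ ℝ² × ℝ²` it is the map `(θ, w) ↦ (circlePoint θ, w)` of vector spaces, whose
derivative `(a, b) ↦ (a • γ'(θ), b)` is injective as `γ' (θ) = (-sin θ, cos θ) ≠ 0`
(`deriv_coe_circlePoint_ne_zero`). [folklore] -/
theorem mfderiv_angleParam_injective (q : ℝ × 𝔼 2) :
    Injective (mfderiv 𝓘(ℝ, ℝ × 𝔼 2) 𝓘₁₂ angleParam q) := by
  have hn : (∞ : WithTop ℕ∞) ≠ 0 := by simp
  set J : (𝕊 1) × 𝔼 2 → (𝔼 2) × 𝔼 2 := fun p ↦ ((p.1 : 𝔼 2), p.2) with hJ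
  have hJs : ContMDiff 𝓘₁₂ 𝓘(ℝ, (𝔼 2) × 𝔼 2) ∞ J :=
    (contMDiff_coe_sphere.comp contMDiff_fst).prodMk_space contMDiff_snd
  set γ : ℝ → 𝔼 2 := fun t ↦ ((circlePoint t : 𝕊 1) : 𝔼 2) with hγ
  set Φ : ℝ × 𝔼 2 → (𝔼 2) × 𝔼 2 := J ∘ angleParam with hΦ
  have hΦ' : Φ = fun q : ℝ × 𝔼 2 ↦ (γ q.1, q.2) := rfl
  -- the derivative of `Φ`
  set L : (ℝ × 𝔼 2) →L[ℝ] (𝔼 2) × 𝔼 2 :=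
    ((ContinuousLinearMap.fst ℝ ℝ (𝔼 2)).smulRight (deriv γ q.1)).prod
      (ContinuousLinearMap.snd ℝ ℝ (𝔼 2)) with hL
  have hγd : HasDerivAt γ (deriv γ q.1) q.1 :=
    ((contDiff_coe_circlePoint.differentiable (by simp)) q.1).hasDerivAt
  have hΦd : HasFDerivAt Φ L q := by
    rw [hΦ']
    have h1 : HasFDerivAt (fun q : ℝ × 𝔼 2 ↦ γ q.1)
        ((ContinuousLinearMap.fst ℝ ℝ (𝔼 2)).smulRight (deriv γ q.1)) q := by
      have := hγd.hasFDerivAt.comp q (hasFDerivAt_fst (𝕜 := ℝ) (E := ℝ) (F := 𝔼 2) (p := q))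
      refine this.congr_fderiv ?_
      ext v <;> simp
    exact h1.prodMk (hasFDerivAt_snd (𝕜 := ℝ) (E := ℝ) (F := 𝔼 2) (p := q))
  -- chain rule: `dΦ = dJ ∘ d(angleParam)`
  have hcomp : mfderiv 𝓘(ℝ, ℝ × 𝔼 2) 𝓘(ℝ, (𝔼 2) × 𝔼 2) Φ q =
      (mfderiv 𝓘₁₂ 𝓘(ℝ, (𝔼 2) × 𝔼 2) J (angleParam q)).comp
        (mfderiv 𝓘(ℝ, ℝ × 𝔼 2) 𝓘₁₂ angleParam q) :=
    mfderiv_comp q (hJs.mdifferentiableAt hn) (contMDiff_angleParam.mdifferentiableAt hn)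
  have hΦL : mfderiv 𝓘(ℝ, ℝ × 𝔼 2) 𝓘(ℝ, (𝔼 2) × 𝔼 2) Φ q = L := by
    rw [mfderiv_eq_fderiv, hΦd.fderiv]
  have hLinj : Injective L := by
    intro v w hvw
    have h1 := congrArg Prod.fst hvw
    have h2 := congrArg Prod.snd hvw
    simp only [hL, ContinuousLinearMap.prod_apply, ContinuousLinearMap.smulRight_apply,
      ContinuousLinearMap.coe_fst', ContinuousLinearMap.coe_snd'] at h1 h2
    have hv1 : v.1 = w.1 := by
      have key : (v.1 - w.1) • deriv γ q.1 = 0 := by rw [sub_smul, h1, sub_self]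
      rcases smul_eq_zero.1 key with h | h
      · exact sub_eq_zero.1 h
      · exact absurd h (deriv_coe_circlePoint_ne_zero q.1)
    exact Prod.ext hv1 h2
  rw [← hΦL, hcomp] at hLinj
  exact Injective.of_comp hLinj

end AngleParam

/-! ### The frame determinant of a map `S¹ × ℝ² → S³` -/

section FrameDet

variable (f : (𝕊 1) × 𝔼 2 → 𝕊 3)

/-- The **coordinate expression** `(θ, w) ↦ f (circlePoint θ, w) ∈ ℝ⁴` of a map
`S¹ × ℝ² → S³` (the map differentiated in `Knot.TubularNbhd.det_pos`). [folklore] -/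
def coordOf (q : ℝ × 𝔼 2) : 𝔼 4 := ((f (angleParam q) : 𝕊 3) : 𝔼 4)

/-- Unfolding of `coordOf`. [folklore] -/
theorem coordOf_apply (θ : ℝ) (w : 𝔼 2) :
    coordOf f (θ, w) = ((f (circlePoint θ, w) : 𝕊 3) : 𝔼 4) := rfl

/-- The coordinate expression as a composition. [folklore] -/
theorem coordOf_eq_comp : coordOf f = (Subtype.val ∘ f) ∘ angleParam := rfl

variable {f}

/-- The coordinate expression of a smooth map is smooth. [folklore] -/
theorem contDiff_coordOf (hf : ContMDiff 𝓘₁₂ (𝓡 3) ∞ f) : ContDiff ℝ ∞ (coordOf f) := by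
  rw [← contMDiff_iff_contDiff, coordOf_eq_comp]
  exact (contMDiff_coe_sphere.comp hf).comp contMDiff_angleParam

/-- **The frame determinant of a local diffeomorphism never vanishes**: the three derivative rows
are the images of a basis of `ℝ × ℝ²` under the injective linear map
`d(S³ ⊆ ℝ⁴) ∘ df ∘ d(angleParam)`, all orthogonal to the unit position vector, so the four rows
are independent (`frameDet_ne_zero_of_injective`). [folklore] -/
theorem tubeFrameDet_coordOf_ne_zero (hloc : IsLocalDiffeomorph 𝓘₁₂ (𝓡 3) ∞ f) (q : ℝ × 𝔼 2) :
    tubeFrameDet (coordOf f) q ≠ 0 := by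
  have hf : ContMDiff 𝓘₁₂ (𝓡 3) ∞ f := hloc.contMDiff
  have hn : (∞ : WithTop ℕ∞) ≠ 0 := by simp
  rw [tubeFrameDet_def, ← mfderiv_eq_fderiv, coordOf_eq_comp,
    mfderiv_comp q ((contMDiff_coe_sphere.comp hf).mdifferentiableAt hn)
      (contMDiff_angleParam.mdifferentiableAt hn),
    mfderiv_comp (angleParam q) (contMDiff_coe_sphere.mdifferentiableAt hn)
      (hf.mdifferentiableAt hn)]
  set A := mfderiv (𝓡 3) 𝓘(ℝ, 𝔼 4) (Subtype.val : 𝕊 3 → 𝔼 4) (f (angleParam q)) with hA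
  set B := mfderiv 𝓘₁₂ (𝓡 3) f (angleParam q) with hB
  set C := mfderiv 𝓘(ℝ, ℝ × 𝔼 2) 𝓘₁₂ angleParam q with hC
  have hAi : Injective A := mfderiv_coe_sphere_injective (n := 3) _
  have hBi : Injective B := by
    rw [hB, ← (hloc (angleParam q)).mfderivToContinuousLinearEquiv_coe hn]
    exact ContinuousLinearEquiv.injective _
  have hCi : Injective C := mfderiv_angleParam_injective q
  refine frameDet_ne_zero_of_injective (norm_eq_of_mem_sphere _)
    (show Injective (⇑A ∘ ⇑B ∘ ⇑C) from (hAi.comp hBi).comp hCi) fun x ↦ ?_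
  have hmem : A (B (C x)) ∈ (A : TangentSpace (𝓡 3) (f (angleParam q)) →L[ℝ] 𝔼 4).range :=
    ⟨B (C x), rfl⟩
  rw [hA, range_mfderiv_coe_sphere] at hmem
  exact (Submodule.mem_orthogonal_singleton_iff_inner_left).1 hmem

/-- The frame determinant of a smooth map is continuous. [folklore] -/
theorem continuous_tubeFrameDet_coordOf (hf : ContMDiff 𝓘₁₂ (𝓡 3) ∞ f) :
    Continuous (tubeFrameDet (coordOf f)) :=
  continuous_tubeFrameDet ((contDiff_coordOf hf).of_le (by simp))

/-- **The frame determinant of a local diffeomorphism has constant sign** (it is continuous and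
never zero on the connected `ℝ × ℝ²`; intermediate value theorem). [folklore] -/
theorem tubeFrameDet_coordOf_pos_or_neg (hloc : IsLocalDiffeomorph 𝓘₁₂ (𝓡 3) ∞ f) :
    (∀ q, 0 < tubeFrameDet (coordOf f) q) ∨ ∀ q, tubeFrameDet (coordOf f) q < 0 := by
  have hf : ContMDiff 𝓘₁₂ (𝓡 3) ∞ f := hloc.contMDiff
  by_contra hcon
  rw [not_or, not_forall, not_forall] at hcon
  obtain ⟨⟨q₁, hq₁⟩, ⟨q₂, hq₂⟩⟩ := hcon
  rw [not_lt] at hq₁ hq₂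
  obtain ⟨q, hq⟩ : ∃ q, tubeFrameDet (coordOf f) q = 0 :=
    intermediate_value_univ q₁ q₂ (continuous_tubeFrameDet_coordOf hf) ⟨hq₁, hq₂⟩
  exact tubeFrameDet_coordOf_ne_zero hloc q hq

/-! ### The fibre reflection -/

/-- The fibre reflection `(x, w) ↦ (x, (w₀, -w₁))` of `S¹ × ℝ²`, a diffeomorphism. [folklore] -/
def fibreReflDiffeo : ((𝕊 1) × 𝔼 2) ≃ₘ⟮𝓘₁₂, 𝓘₁₂⟯ ((𝕊 1) × 𝔼 2) :=
  Diffeomorph.prodCongr (Diffeomorph.refl (𝓡 1) (𝕊 1) ∞) planeFlip.toDiffeomorph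

/-- The fibre reflection diffeomorphism on points. [folklore] -/
@[simp] theorem fibreReflDiffeo_apply (q : (𝕊 1) × 𝔼 2) :
    fibreReflDiffeo q = (q.1, planeFlip q.2) := rfl

variable (f)

/-- The **fibre-reflected map** `(x, w) ↦ f (x, (w₀, -w₁))`. [folklore] -/
def fibreReflect (q : (𝕊 1) × 𝔼 2) : 𝕊 3 := f (q.1, planeFlip q.2)

/-- The fibre-reflected map as a composition with the reflection diffeomorphism. [folklore] -/
theorem fibreReflect_eq_comp : fibreReflect f = f ∘ fibreReflDiffeo := rfl

variable {f}

/-- The fibre-reflected map of a smooth map is smooth. [folklore] -/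
theorem contMDiff_fibreReflect (hf : ContMDiff 𝓘₁₂ (𝓡 3) ∞ f) :
    ContMDiff 𝓘₁₂ (𝓡 3) ∞ (fibreReflect f) := by
  rw [fibreReflect_eq_comp]
  exact hf.comp fibreReflDiffeo.contMDiff

/-- The fibre-reflected map of a local diffeomorphism is a local diffeomorphism. [folklore] -/
theorem isLocalDiffeomorph_fibreReflect (hloc : IsLocalDiffeomorph 𝓘₁₂ (𝓡 3) ∞ f) :
    IsLocalDiffeomorph 𝓘₁₂ (𝓡 3) ∞ (fibreReflect f) := fun q ↦ by
  rw [fibreReflect_eq_comp]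
  exact IsLocalDiffeomorphAt.comp (hf := fibreReflDiffeo.isLocalDiffeomorph q) (hg := hloc _)

/-- The fibre-reflected map of an injective map is injective. [folklore] -/
theorem fibreReflect_injective (hinj : Injective f) : Injective (fibreReflect f) := by
  rw [fibreReflect_eq_comp]
  exact hinj.comp fibreReflDiffeo.injective

/-- The coordinate expression of the fibre-reflected map is the coordinate expression composed
with the linear map `id × reflection`. [folklore] -/
theorem coordOf_fibreReflect_eq_comp : coordOf (fibreReflect f) =
    coordOf f ∘ ⇑((ContinuousLinearMap.id ℝ ℝ).prodMap (planeFlip : (𝔼 2) →L[ℝ] 𝔼 2)) := rfl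

/-- Changing the sign of the last row changes the sign of `frameDet`. [folklore] -/
theorem frameDet_neg_last (r₀ r₁ r₂ r₃ : 𝔼 4) : frameDet r₀ r₁ r₂ (-r₃) = -frameDet r₀ r₁ r₂ r₃ := by
  have h := frameDet_comb₂ r₀ r₁ r₂ r₃ 1 0 0 (-1)
  simp only [one_smul, zero_smul, add_zero, zero_add, neg_smul, mul_zero, sub_zero, one_mul,
    neg_mul] at h
  exact h

/-- **The fibre reflection changes the sign of the frame determinant**: at `(θ, w)` the frame of
the reflected map is the frame of `f` at `(θ, (w₀, -w₁))` with the last row negated. [folklore] -/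
theorem tubeFrameDet_coordOf_fibreReflect (hf : ContMDiff 𝓘₁₂ (𝓡 3) ∞ f) (θ : ℝ) (w : 𝔼 2) :
    tubeFrameDet (coordOf (fibreReflect f)) (θ, w) =
      -tubeFrameDet (coordOf f) (θ, planeFlip w) := by
  set L : (ℝ × 𝔼 2) →L[ℝ] ℝ × 𝔼 2 :=
    (ContinuousLinearMap.id ℝ ℝ).prodMap (planeFlip : (𝔼 2) →L[ℝ] 𝔼 2) with hL
  have hLq : L (θ, w) = (θ, planeFlip w) := rfl
  have hdiff : DifferentiableAt ℝ (coordOf f) (L (θ, w)) :=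
    ((contDiff_coordOf hf).differentiable (by simp)) _
  have hfd : fderiv ℝ (coordOf (fibreReflect f)) (θ, w) = (fderiv ℝ (coordOf f) (θ, planeFlip w)).comp L := by
    rw [coordOf_fibreReflect_eq_comp, ← hL, fderiv_comp (θ, w) hdiff L.differentiableAt, L.fderiv, hLq]
  rw [tubeFrameDet_def, tubeFrameDet_def, hfd]
  have hval : coordOf (fibreReflect f) (θ, w) = coordOf f (θ, planeFlip w) := rfl
  simp only [ContinuousLinearMap.coe_comp, comp_apply, hval]
  have h1 : L ((1 : ℝ), (0 : 𝔼 2)) = (1, 0) := by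
    change ((ContinuousLinearMap.id ℝ ℝ) 1, planeFlip 0) = ((1 : ℝ), (0 : 𝔼 2))
    rw [map_zero]; rfl
  have h2 : L ((0 : ℝ), EuclideanSpace.single 0 (1 : ℝ)) = (0, EuclideanSpace.single 0 1) := by
    change ((ContinuousLinearMap.id ℝ ℝ) 0, planeFlip (EuclideanSpace.single 0 (1 : ℝ))) =
      ((0 : ℝ), EuclideanSpace.single 0 (1 : ℝ))
    rw [planeFlip_single_zero]; rfl
  have h3 : L ((0 : ℝ), EuclideanSpace.single 1 (1 : ℝ)) = (0, -EuclideanSpace.single 1 1) := by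
    change ((ContinuousLinearMap.id ℝ ℝ) 0, planeFlip (EuclideanSpace.single 1 (1 : ℝ))) =
      ((0 : ℝ), -EuclideanSpace.single 1 (1 : ℝ))
    rw [planeFlip_single_one]
    have : EuclideanSpace.single (1 : Fin 2) (-(1 : ℝ)) = -EuclideanSpace.single 1 1 := by
      ext i; fin_cases i <;> simp
    rw [this]; rfl
  rw [h1, h2, h3]
  have h5 : (fderiv ℝ (coordOf f) (θ, planeFlip w)) ((0 : ℝ), -EuclideanSpace.single 1 (1 : ℝ)) =
      -(fderiv ℝ (coordOf f) (θ, planeFlip w)) ((0 : ℝ), EuclideanSpace.single 1 (1 : ℝ)) := by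
    rw [← map_neg, Prod.neg_mk, neg_zero]
  rw [h5, frameDet_neg_last]

end FrameDet

/-! ### The oriented tubular neighbourhood -/

namespace Knot.TubularNbhd

variable {K : Knot} {f : (𝕊 1) × 𝔼 2 → 𝕊 3}

/-- `dim (S¹ × ℝ²) = dim S³` as an identification of model vector spaces. [folklore] -/
def modelIso₁₂ : (EuclideanSpace ℝ (Fin 1) × 𝔼 2) ≃L[ℝ] 𝔼 3 :=
  ContinuousLinearEquiv.ofFinrankEq finrank_model_prod_eq

/-- The orientation condition `det_pos` from positivity of the frame determinant. [folklore] -/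
theorem det_pos_of_tubeFrameDet_pos (hf : ContMDiff 𝓘₁₂ (𝓡 3) ∞ f)
    (hpos : ∀ q, 0 < tubeFrameDet (coordOf f) q) (θ : ℝ) (w : 𝔼 2) :
    0 < Matrix.det (Matrix.of
      ![⇑((f (circlePoint θ, w) : 𝕊 3) : 𝔼 4),
        ⇑(deriv (fun t : ℝ ↦ ((f (circlePoint t, w) : 𝕊 3) : 𝔼 4)) θ),
        ⇑(deriv (fun s : ℝ ↦ ((f (circlePoint θ, w + EuclideanSpace.single 0 s) : 𝕊 3) : 𝔼 4)) 0),
        ⇑(deriv (fun s : ℝ ↦ ((f (circlePoint θ, w + EuclideanSpace.single 1 s) : 𝕊 3) : 𝔼 4)) 0)]) := by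
  have := hpos (θ, w)
  rwa [tubeFrameDet_eq_det_deriv ((contDiff_coordOf hf).differentiable (by simp))] at this

/-- The tubular neighbourhood structure on a positively oriented injective local diffeomorphism
extending `K`. [folklore] -/
def ofPos (hloc : IsLocalDiffeomorph 𝓘₁₂ (𝓡 3) ∞ f) (hinj : Injective f)
    (hK : ∀ x, f (x, 0) = K x) (hpos : ∀ q, 0 < tubeFrameDet (coordOf f) q) :
    Knot.TubularNbhd K where
  toFun := f
  isSmoothEmbedding := isSmoothEmbedding_of_isLocalDiffeomorph hloc hinj modelIso₁₂
  apply_zero := hK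
  det_pos := det_pos_of_tubeFrameDet_pos hloc.contMDiff hpos

/-- `ofPos` as a function is `f`. [folklore] -/
@[simp] theorem ofPos_apply (hloc : IsLocalDiffeomorph 𝓘₁₂ (𝓡 3) ∞ f) (hinj : Injective f)
    (hK : ∀ x, f (x, 0) = K x) (hpos : ∀ q, 0 < tubeFrameDet (coordOf f) q)
    (q : (𝕊 1) × 𝔼 2) : ofPos hloc hinj hK hpos q = f q := rfl

open Classical in
/-- **An oriented tubular neighbourhood from an injective local diffeomorphism.** Let
`f : S¹ × ℝ² → S³` be a smooth injective local diffeomorphism with `f (x, 0) = K x`. Then `f`, or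
else its fibre reflection `(x, w) ↦ f (x, (w₀, -w₁))`, is an oriented tubular neighbourhood of
`K`: both are smooth embeddings extending `K`, and exactly one of them satisfies the orientation
convention `det_pos`, the frame determinant having constant sign
(`tubeFrameDet_coordOf_pos_or_neg`) which the reflection flips
(`tubeFrameDet_coordOf_fibreReflect`). Hirsch (1976), Ch. 4 §5. [folklore] -/
def ofLocalDiffeomorph (hloc : IsLocalDiffeomorph 𝓘₁₂ (𝓡 3) ∞ f) (hinj : Injective f)
    (hK : ∀ x, f (x, 0) = K x) : Knot.TubularNbhd K :=
  if hpos : ∀ q, 0 < tubeFrameDet (coordOf f) q then ofPos hloc hinj hK hpos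
  else ofPos (isLocalDiffeomorph_fibreReflect hloc) (fibreReflect_injective hinj) (fun x ↦ by
      change f (x, planeFlip 0) = K x
      rw [map_zero, hK]) (fun q ↦ by
      obtain ⟨θ, w⟩ := q
      rw [tubeFrameDet_coordOf_fibreReflect hloc.contMDiff]
      have hneg := (tubeFrameDet_coordOf_pos_or_neg hloc).resolve_left hpos (θ, planeFlip w)
      linarith)

/-- If `f` is positively oriented, the tubular neighbourhood of `ofLocalDiffeomorph` is `f`. [folklore] -/
theorem ofLocalDiffeomorph_apply_of_pos (hloc : IsLocalDiffeomorph 𝓘₁₂ (𝓡 3) ∞ f) (hinj : Injective f)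
    (hK : ∀ x, f (x, 0) = K x) (hpos : ∀ q, 0 < tubeFrameDet (coordOf f) q) (q : (𝕊 1) × 𝔼 2) :
    ofLocalDiffeomorph hloc hinj hK q = f q := by
  rw [ofLocalDiffeomorph, dif_pos hpos]; rfl

/-- If `f` is not positively oriented, the tubular neighbourhood of `ofLocalDiffeomorph` is the
fibre reflection of `f`. [folklore] -/
theorem ofLocalDiffeomorph_apply_of_not_pos (hloc : IsLocalDiffeomorph 𝓘₁₂ (𝓡 3) ∞ f)
    (hinj : Injective f) (hK : ∀ x, f (x, 0) = K x) (hpos : ¬∀ q, 0 < tubeFrameDet (coordOf f) q)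
    (q : (𝕊 1) × 𝔼 2) : ofLocalDiffeomorph hloc hinj hK q = f (q.1, planeFlip q.2) := by
  rw [ofLocalDiffeomorph, dif_neg hpos]; rfl

/-- **The tubular neighbourhood of `ofLocalDiffeomorph` is `f` or its fibre reflection.** [folklore] -/
theorem ofLocalDiffeomorph_apply_or (hloc : IsLocalDiffeomorph 𝓘₁₂ (𝓡 3) ∞ f) (hinj : Injective f)
    (hK : ∀ x, f (x, 0) = K x) :
    (∀ q, ofLocalDiffeomorph hloc hinj hK q = f q) ∨
      ∀ q, ofLocalDiffeomorph hloc hinj hK q = f (q.1, planeFlip q.2) := by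
  by_cases hpos : ∀ q, 0 < tubeFrameDet (coordOf f) q
  · exact Or.inl (ofLocalDiffeomorph_apply_of_pos hloc hinj hK hpos)
  · exact Or.inr (ofLocalDiffeomorph_apply_of_not_pos hloc hinj hK hpos)

end Knot.TubularNbhd

end Literature.Topology.FourManifolds
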